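import Summits.ValiantsHypothesis.ValiantsHypothesis.Theses.GeneratorObstructions
import Literature.Barriers.ValiantsHypothesis.GCTMatrixPoweringCor9
import HarnessLib

/-!
# Route GeneratorObstructions — `PowTraceMembership` (GIP17 Prop. 5 in point form)

Item `stmt-ValiantsHypothesis-11660` of route `route-ValiantsHypothesis-GeneratorObstructions`:
if `per_m = tr(A^m)` for an `n' × n'` matrix `A` of homogeneous linear forms in the `m²`
variables, `1 ≤ m` and `n' ≤ n = m + e`, then the permanent placed on the top-left `m × m` block
of the lexicographic `n × n` matrix variables lies in the orbit closure
`\overline{GL_{n²} · tr X^m}` of the power trace `powFormLex ℂ n m`.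

The proof is the tree's discharge of Gesmundo–Ikenmeyer–Panova 2017, Prop. 5
(`Literature.Barriers.ValiantsHypothesis.blockPerFormLex_mem_orbitClosure_powFormLex`: pad `A` by
zeros to size `n`, `HasPowTraceRepr.of_le`; substitute `X_{ab} ↦ A_{ab}` — a linear endomorphism
carrying `tr X^m` to the block permanent; `End · f ⊆ Δ[f]`, `endOrbit_subset_orbitClosure_holds`),
transported from the barrier catalogue's `blockPerFormLex m n` to the route's literal
`rename (fun ij => toLex (Fin.castAdd e ij.1, Fin.castAdd e ij.2)) (perPoly (Fin m) ℂ)` by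
`blockPerFormLex_eq_rename` (`Fin.castAdd e = Fin.castLE (Nat.le_add_right m e)` by definition).

## References

* F. Gesmundo, C. Ikenmeyer, G. Panova, *Geometric complexity theory and matrix powering*,
  Diff. Geom. Appl. 55 (2017) 106–127 = arXiv:1611.00827, §2.2, Prop. 5.
  [GesmundoIkenmeyerPanova2017]
* K. Mulmuley, M. Sohoni, *Geometric complexity theory I*, SIAM J. Comput. 31 (2001), Prop. 4.4
  (the padded template). [MulmuleySohoni2001]
-/

-- `Summit.ValiantsHypothesis.ValiantsHypothesis.…` is the tree's mandated single-conjunct layout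
-- (Sub = Summit), so the duplicated namespace component is intended.
set_option linter.dupNamespace false

namespace Summit.ValiantsHypothesis.ValiantsHypothesis.Theorems.GeneratorObstructions

open Literature.NumberTheory.DiophantineGeometry Literature.Computability.AlgebraicComplexity
  Literature.Barriers.ValiantsHypothesis

/-- **`PowTraceMembership` holds** (Gesmundo–Ikenmeyer–Panova 2017, Prop. 5, point form): a
power-trace representation `per_m = tr(A^m)` of size `n' ≤ m + e` by homogeneous linear forms puts
the block permanent `per_m` (top-left `m × m` block of the lexicographic `(m+e) × (m+e)` matrix
variables) into `\overline{GL_{(m+e)²} · tr X^m}`. Proof: pad `A` to size `m + e`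
(`HasPowTraceRepr.of_le`, needs `1 ≤ m`), apply the tree's Prop. 5
`blockPerFormLex_mem_orbitClosure_powFormLex`, and rewrite `blockPerFormLex m (m+e)` as the
route's `rename` of `perPoly` (`blockPerFormLex_eq_rename`). -/
theorem powTraceMembership_proof :
    Summit.ValiantsHypothesis.ValiantsHypothesis.Theses.GeneratorObstructions.PowTraceMembership := by
  unfold Summit.ValiantsHypothesis.ValiantsHypothesis.Theses.GeneratorObstructions.PowTraceMembership
  intro m e n' hm hn' hA
  have h : HasPowTraceRepr ℂ (perPoly (Fin m) ℂ) m (m + e) :=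
    HasPowTraceRepr.of_le hm hn' hA
  have hmem := blockPerFormLex_mem_orbitClosure_powFormLex (Nat.le_add_right m e) h
  rw [blockPerFormLex_eq_rename (Nat.le_add_right m e)] at hmem
  exact hmem

end Summit.ValiantsHypothesis.ValiantsHypothesis.Theorems.GeneratorObstructions
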